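import Literature.AnabelianGeometry.AbsoluteAnabelian.AbsTopIII.FrobeniusPictureMLF
import HarnessLib

/-!
# [AbsTopIII] Cor. 4.5 (iii), proof: paths of the diagram `𝒟_{≤3}` and their lowering

Mochizuki, *Topics in Absolute Anabelian Geometry III*, proof of Corollary 4.5 (iii), pp. 109–110
(bib key `MochizukiAbsTopIII2015`; lit key `paper:url-5493eb38cbb7`, kurims manuscript pages): the
observable `𝔖_log` is the family of
homotopies on `𝒟_{≤3}` whose boundary set `E_log` consists of the pairs of paths of types (1)–(4)
("composing, in an alternating fashion, various pull-backs of `ι_log,⋎` with various pull-backs of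
`ι_×`") and the reflexive pairs (5).  This file is the ORIENTATION-FREE path combinatorics of the
quiver of `𝒟_{≤3}` (t2's `LogFrobeniusData.logObsShape` / `sub3`, t5's `lvRow1`/`lvNexus`/`lvObs`,
`eLamTimes`/`eLamPf`, `logPairLeft`/`logPairRight`) needed to CONSTRUCT that family:
the number of `log`s and the LEVEL of a path (`2k` for `[λ^×]∘[id]∘[log]ᵏ`, `2k+1` for
`[λ^∼]∘[id]∘[log]ᵏ`), the one-step LOWERING `lower` (a final `λ^∼` becomes `λ^×`;
`[λ^×]∘[id_⋎]∘[log]`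
becomes `[λ^∼]∘[id_{⋎+1}]`; bottom paths fixed — all by structural recursion, no index arithmetic),
the
case analysis of edges and vertices, and `level_lower` / `lower_comp_of_level_pos`.  Companion
files:
`LogObservableLevels.lean` (uniqueness of paths of given level, the boundary set),
`AutHolLogFrobeniusDescent.lean` / `AutHolLogFrobeniusObservable.lean` (the homotopies and the
family; block W2-B4 of the abc-iut cell, seat abc-iut-L4-t10).  Usable verbatim for Cor. 3.6 (iii).
-/

namespace Literature.AnabelianGeometry.AbsoluteAnabelian.AbsTopIII

open _root_.CategoryTheory _root_.Quiver LogFrobeniusData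

universe u

/-- Shorthand: the vertex type of `𝒟_{≤3}` (`sub3`).
[cite: MochizukiAbsTopIII2015, Corollary 4.5 (iii) p.109] -/
abbrev V3 : Type := LogFrobeniusData.logObsShape.{u}.Vertex

/-- A vertex of `𝒟_{≤3}` is a first-row vertex `⋎ = n`, the nexus `□`, or the observation vertex `𝒩`
(the other `LFVertex` constructors have row `> 2`).
[cite: MochizukiAbsTopIII2015, Corollary 4.5 (iii) p.109] -/
theorem V3.cases (x : V3.{u}) :
    (∃ n, x = lvRow1.{u} n) ∨ x = lvNexus.{u} ∨ x = lvObs.{u} := by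
  rcases x with ⟨a, ha⟩ | _
  · rcases a with n | _ | _ | _ | _ | _
    · exact Or.inl ⟨n, rfl⟩
    · exact Or.inr (Or.inl rfl)
    all_goals exact absurd ha (by simp [LFVertex.row])
  · exact Or.inr (Or.inr rfl)

/-- Number of `log`-edges contributed by one edge: `1` for an edge between first-row vertices.
[cite: MochizukiAbsTopIII2015, Corollary 4.5 (iii) p.109] -/
def edgeLogs : ∀ (x y : V3.{u}), (x ⟶ y) → ℕ
  | .base ⟨.row1 _, _⟩, .base ⟨.row1 _, _⟩, _ => 1
  | _, _, _ => 0

/-- Whether an edge is the observation edge `λ^×` (`true`) — as opposed to `λ^∼` / anything else.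
[cite: MochizukiAbsTopIII2015, Corollary 4.5 (iii) p.109] -/
def edgeTimes : ∀ (x y : V3.{u}), (x ⟶ y) → Bool
  | .base ⟨.nexus, _⟩, .obs, i => ULift.down i
  | _, _, _ => false

/-- Number of `log`-edges on a path.
[cite: MochizukiAbsTopIII2015, Corollary 4.5 (iii) p.109] -/
def nlogs {a : V3.{u}} : ∀ {b : V3.{u}}, Path a b → ℕ
  | _, .nil => 0
  | _, .cons (b := b) (c := c) p e => nlogs p + edgeLogs b c e

/-- The last edge of a path is `λ^×`.
[cite: MochizukiAbsTopIII2015, Corollary 4.5 (iii) p.109] -/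
def lastTimes {a : V3.{u}} : ∀ {b : V3.{u}}, Path a b → Bool
  | _, .nil => true
  | _, .cons (b := b) (c := c) _ e => edgeTimes b c e

/-- The LEVEL of a path into `𝒩`: `2k` for `[λ^×]∘[id]∘[log]^k`, `2k+1` for `[λ^∼]∘[id]∘[log]^k`.
[cite: MochizukiAbsTopIII2015, Corollary 4.5 (iii) p.109] -/
def level {a b : V3.{u}} (p : Path a b) : ℕ := 2 * nlogs p + (if lastTimes p then 0 else 1)

/-- `nlogs` is additive under composition of paths. [cite: MochizukiAbsTopIII2015, Corollary 4.5
(iii) p.109] -/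
theorem nlogs_comp {a b c : V3.{u}} (r : Path a b) (p : Path b c) :
    nlogs (r.comp p) = nlogs r + nlogs p := by
  induction p with
  | nil => rfl
  | cons p e ih => simp only [Path.comp_cons, nlogs, ih, Nat.add_assoc]

/-- The last edge of a composite is the last edge of the second path. [cite: MochizukiAbsTopIII2015,
Corollary 4.5 (iii) p.109] -/
theorem lastTimes_comp_cons {a b c d : V3.{u}} (r : Path a b) (p : Path b c) (e : c ⟶ d) :
    lastTimes (r.comp (p.cons e)) = lastTimes (p.cons e) := rfl

/-- test computations
[cite: MochizukiAbsTopIII2015, Corollary 4.5 (iii) p.109] -/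
example (n : ℤ) : level (logPairLeft.{u} n) = 2 := by rfl
example (n : ℤ) : level (logPairRight.{u} n) = 1 := by rfl
example : level ((Path.nil : Path lvNexus.{u} lvNexus).cons eLamPf) = 1 := by rfl
example : level ((Path.nil : Path lvNexus.{u} lvNexus).cons eLamTimes) = 0 := by rfl

/-! ### One-step lowering of paths into `𝒩` -/

/-- The nexus vertex presented with an arbitrary membership proof.
[cite: MochizukiAbsTopIII2015, Corollary 4.5 (iii) p.109] -/
abbrev vNexus (h : LFVertex.nexus ∈ {a : LFVertex | a.row ≤ 2}) : V3.{u} :=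
  logObsShape.{u}.base ⟨.nexus, h⟩

/-- A first-row vertex presented with an arbitrary membership proof.
[cite: MochizukiAbsTopIII2015, Corollary 4.5 (iii) p.109] -/
abbrev vRow1 (m : ℤ) (hm : LFVertex.row1 m ∈ {a : LFVertex | a.row ≤ 2}) : V3.{u} :=
  logObsShape.{u}.base ⟨.row1 m, hm⟩

/-- The edge `λ^×` out of the nexus vertex.
[cite: MochizukiAbsTopIII2015, Corollary 4.5 (iii) p.109] -/
def eTimesAt (h : LFVertex.nexus ∈ {a : LFVertex | a.row ≤ 2}) : (vNexus.{u} h ⟶ lvObs.{u}) :=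
  (⟨true⟩ : ULift Bool)

/-- The edge `λ^∼` out of the nexus vertex.
[cite: MochizukiAbsTopIII2015, Corollary 4.5 (iii) p.109] -/
def ePfAt (h : LFVertex.nexus ∈ {a : LFVertex | a.row ≤ 2}) : (vNexus.{u} h ⟶ lvObs.{u}) :=
  (⟨false⟩ : ULift Bool)

/-- The edge `id_m : (⋎ = m) → □`.
[cite: MochizukiAbsTopIII2015, Corollary 4.5 (iii) p.109] -/
def eIdAt (m : ℤ) (hm : LFVertex.row1 m ∈ {a : LFVertex | a.row ≤ 2})
    (h : LFVertex.nexus ∈ {a : LFVertex | a.row ≤ 2}) : (vRow1.{u} m hm ⟶ vNexus.{u} h) :=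
  show (LFVertex.row1 m ⟶ LFVertex.nexus) from LFVertex.idEdge m

/-- Lowering, innermost layer: the source of the last `log`.
[cite: MochizukiAbsTopIII2015, Corollary 4.5 (iii) p.109] -/
def lowerLog2 (h : LFVertex.nexus ∈ {a : LFVertex | a.row ≤ 2}) (n : ℤ)
    (hn : LFVertex.row1 n ∈ {a : LFVertex | a.row ≤ 2}) {a : V3.{u}} :
    ∀ (x : V3.{u}) (_p₂ : Path a x) (_e₂ : x ⟶ vRow1.{u} n hn) (_e₁ : vRow1.{u} n hn ⟶ vNexus.{u}
h),
      Path a lvObs.{u}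
  | .base ⟨.row1 m, hm⟩, p₂, _, _ => (p₂.cons (eIdAt m hm h)).cons (ePfAt h)
  | _, p₂, e₂, e₁ => ((p₂.cons e₂).cons e₁).cons (eTimesAt h)

/-- Lowering: the layer of the `id`-edge source (a chain of `log`s or empty).
[cite: MochizukiAbsTopIII2015, Corollary 4.5 (iii) p.109] -/
def lowerLog (h : LFVertex.nexus ∈ {a : LFVertex | a.row ≤ 2}) (n : ℤ)
    (hn : LFVertex.row1 n ∈ {a : LFVertex | a.row ≤ 2}) :
    ∀ {a : V3.{u}} (_p₁ : Path a (vRow1.{u} n hn)) (_e₁ : vRow1.{u} n hn ⟶ vNexus.{u} h),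
      Path a lvObs.{u}
  | _, .nil, e₁ => ((Path.nil : Path (vRow1.{u} n hn) (vRow1 n hn)).cons e₁).cons (eTimesAt h)
  | _, .cons (b := x) p₂ e₂, e₁ => lowerLog2 h n hn x p₂ e₂ e₁

/-- Lowering: the layer of the `id`-edge.
[cite: MochizukiAbsTopIII2015, Corollary 4.5 (iii) p.109] -/
def lowerId (h : LFVertex.nexus ∈ {a : LFVertex | a.row ≤ 2}) {a : V3.{u}} :
    ∀ (x : V3.{u}) (_p₁ : Path a x) (_e₁ : x ⟶ vNexus.{u} h), Path a lvObs.{u}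
  | .base ⟨.row1 n, hn⟩, p₁, e₁ => lowerLog h n hn p₁ e₁
  | _, p₁, e₁ => (p₁.cons e₁).cons (eTimesAt h)

/-- Lowering when the last edge is `λ^×`.
[cite: MochizukiAbsTopIII2015, Corollary 4.5 (iii) p.109] -/
def lowerTimes (h : LFVertex.nexus ∈ {a : LFVertex | a.row ≤ 2}) :
    ∀ {a : V3.{u}}, Path a (vNexus.{u} h) → Path a lvObs.{u}
  | _, .nil => (Path.nil : Path (vNexus.{u} h) (vNexus h)).cons (eTimesAt h)
  | _, .cons (b := x) p₁ e₁ => lowerId h x p₁ e₁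

/-- Lowering: the layer of the last edge.
[cite: MochizukiAbsTopIII2015, Corollary 4.5 (iii) p.109] -/
def lowerLast {a : V3.{u}} : ∀ (x y : V3.{u}) (_p : Path a x) (_e : x ⟶ y), Path a y
  | .base ⟨.nexus, h⟩, .obs, p, ⟨false⟩ => p.cons (eTimesAt h)
  | .base ⟨.nexus, h⟩, .obs, p, ⟨true⟩ => lowerTimes h p
  | _, _, p, e => p.cons e

/-- **One-step lowering** of a path: identity unless the path ends at `𝒩`; replaces a final `λ^∼`
by `λ^×` (type (4) step, `k` unchanged), or removes the last `log` before `[id]∘[λ^×]` and ends with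
`λ^∼` (type (1) step); the bottom paths `[λ^×]`, `[id]∘[λ^×]` are fixed.
[cite: MochizukiAbsTopIII2015, Corollary 4.5 (iii) p.109] -/
def lower {a : V3.{u}} : ∀ {b : V3.{u}}, Path a b → Path a b
  | _, .nil => .nil
  | _, .cons (b := x) (c := y) p e => lowerLast x y p e

example (n : ℤ) : lower (logPairLeft.{u} n) = logPairRight n := rfl
example : lower ((Path.nil : Path lvNexus.{u} lvNexus).cons eLamPf) =
    (Path.nil : Path lvNexus.{u} lvNexus).cons eLamTimes := rfl
example (n : ℤ) : lower (logPairRight.{u} n) =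
    ((Path.nil : Path (lvRow1.{u} (n+1)) (lvRow1 (n+1))).cons
      (show lvRow1.{u} (n + 1) ⟶ lvNexus from LFVertex.idEdge (n + 1))).cons eLamTimes := rfl
example (n : ℤ) : lower (lower (logPairRight.{u} n)) = lower (logPairRight.{u} n) := rfl

/-! ### Edges and vertices of `𝒟_{≤3}`: case analysis -/

/-- The edge `id_n : (⋎ = n) → □` between the canonical vertices.
[cite: MochizukiAbsTopIII2015, Corollary 4.5 (iii) p.109] -/
def idE (n : ℤ) : (lvRow1.{u} n ⟶ lvNexus.{u}) := show (LFVertex.row1 n ⟶ LFVertex.nexus) from LFVertex.idEdge n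

/-- The edge `log : (⋎ = n+1) → (⋎ = n)` between the canonical vertices.
[cite: MochizukiAbsTopIII2015, Corollary 4.5 (iii) p.109] -/
def logE (n : ℤ) : (lvRow1.{u} (n + 1) ⟶ lvRow1.{u} n) :=
  show (LFVertex.row1 (n + 1) ⟶ LFVertex.row1 n) from LFVertex.logEdge n

/-- Edges into `𝒩` come from `□`. [cite: MochizukiAbsTopIII2015, Corollary 3.6 p.78] -/
theorem eq_nexus_of_hom_obs {x : V3.{u}} (e : x ⟶ lvObs.{u}) : x = lvNexus.{u} := by
  rcases V3.cases x with ⟨n, rfl⟩ | rfl | rfl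
  · exact (show PEmpty from e).elim
  · rfl
  · exact (show PEmpty from e).elim

/-- Edges into `□` come from the first row. [cite: MochizukiAbsTopIII2015, Corollary 3.6 p.78] -/
theorem eq_row1_of_hom_nexus {x : V3.{u}} (e : x ⟶ lvNexus.{u}) : ∃ n, x = lvRow1.{u} n := by
  rcases V3.cases x with ⟨n, rfl⟩ | rfl | rfl
  · exact ⟨n, rfl⟩
  · exact (show PEmpty from e).elim
  · exact (show PEmpty from e).elim

/-- Edges into `⋎ = n` come from `⋎ = n + 1`. [cite: MochizukiAbsTopIII2015, Corollary 3.6 p.78] -/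
theorem eq_row1_of_hom_row1 {x : V3.{u}} {n : ℤ} (e : x ⟶ lvRow1.{u} n) : x = lvRow1.{u} (n + 1) := by
  rcases V3.cases x with ⟨m, rfl⟩ | rfl | rfl
  · obtain ⟨⟨h⟩⟩ := (show ULift (PLift (m = n + 1)) from e)
    subst h
    rfl
  · exact (show PEmpty from e).elim
  · exact (show PEmpty from e).elim

/-- The two edges `□ → 𝒩` are `λ^×` and `λ^∼`. [cite: MochizukiAbsTopIII2015, Corollary 3.6 p.78] -/
theorem hom_obs_eq : ∀ (e : lvNexus.{u} ⟶ lvObs.{u}), e = eLamTimes ∨ e = eLamPf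
  | ⟨true⟩ => Or.inl rfl
  | ⟨false⟩ => Or.inr rfl

/-- The edge `(⋎ = n) → □` is `id_n`. [cite: MochizukiAbsTopIII2015, Corollary 3.6 p.78] -/
theorem hom_nexus_eq {n : ℤ} (e : lvRow1.{u} n ⟶ lvNexus.{u}) : e = idE n := rfl

/-- The edge `(⋎ = n+1) → (⋎ = n)` is `log`. [cite: MochizukiAbsTopIII2015, Corollary 3.6 p.78] -/
theorem hom_row1_eq {n : ℤ} : ∀ (e : lvRow1.{u} (n + 1) ⟶ lvRow1.{u} n), e = logE n
  | ⟨⟨_⟩⟩ => rfl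

/-- No edge leaves `𝒩`. [cite: MochizukiAbsTopIII2015, Corollary 3.6 p.78] -/
theorem isEmpty_hom_obs' (x : V3.{u}) : IsEmpty (lvObs.{u} ⟶ x) := by
  rcases V3.cases x with ⟨n, rfl⟩ | rfl | rfl <;> exact ⟨fun e => (show PEmpty from e).elim⟩

/-! ### Computation rules for `nlogs`, `lastTimes`, `level`, `lower` -/

/-- Computation rule. [cite: MochizukiAbsTopIII2015, Corollary 4.5 (iii) p.109] -/
theorem nlogs_cons_obs {a : V3.{u}} (p₀ : Path a lvNexus.{u}) (e : lvNexus.{u} ⟶ lvObs.{u}) :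
    nlogs (p₀.cons e) = nlogs p₀ := rfl
/-- Computation rule. [cite: MochizukiAbsTopIII2015, Corollary 4.5 (iii) p.109] -/
theorem nlogs_cons_id {a : V3.{u}} {n : ℤ} (p₁ : Path a (lvRow1.{u} n)) :
    nlogs (p₁.cons (idE n)) = nlogs p₁ := rfl
/-- Computation rule. [cite: MochizukiAbsTopIII2015, Corollary 4.5 (iii) p.109] -/
theorem nlogs_cons_log {a : V3.{u}} {n : ℤ} (p₂ : Path a (lvRow1.{u} (n + 1))) :
    nlogs (p₂.cons (logE n)) = nlogs p₂ + 1 := rfl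
/-- The level of `[λ^×]∘γ` is `2·nlogs γ`. [cite: MochizukiAbsTopIII2015, Corollary 4.5 (iii) p.109]
-/
theorem level_cons_lamTimes {a : V3.{u}} (p₀ : Path a lvNexus.{u}) :
    level (p₀.cons eLamTimes) = 2 * nlogs p₀ := rfl
/-- The level of `[λ^∼]∘γ` is `2·nlogs γ + 1`. [cite: MochizukiAbsTopIII2015, Corollary 4.5 (iii)
p.109] -/
theorem level_cons_lamPf {a : V3.{u}} (p₀ : Path a lvNexus.{u}) :
    level (p₀.cons eLamPf) = 2 * nlogs p₀ + 1 := rfl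
/-- Lowering a final `λ^∼` (type (4) step). [cite: MochizukiAbsTopIII2015, Corollary 4.5 (iii)
p.109] -/
theorem lower_cons_lamPf {a : V3.{u}} (p₀ : Path a lvNexus.{u}) :
    lower (p₀.cons eLamPf) = p₀.cons eLamTimes := rfl
/-- The bottom path `[λ^×]` is fixed. [cite: MochizukiAbsTopIII2015, Corollary 4.5 (iii) p.109] -/
theorem lower_nil_lamTimes :
    lower ((Path.nil : Path lvNexus.{u} lvNexus).cons eLamTimes) = Path.nil.cons eLamTimes := rfl
/-- The bottom path `[λ^×]∘[id]` is fixed. [cite: MochizukiAbsTopIII2015, Corollary 4.5 (iii) p.109]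
-/
theorem lower_id_lamTimes (n : ℤ) :
    lower (((Path.nil : Path (lvRow1.{u} n) (lvRow1 n)).cons (idE n)).cons eLamTimes) =
      (Path.nil.cons (idE n)).cons eLamTimes := rfl
/-- Lowering `[λ^×]∘[id_n]∘[log]∘γ` (type (1) step). [cite: MochizukiAbsTopIII2015, Corollary 4.5
(iii) p.109] -/
theorem lower_log_id_lamTimes {a : V3.{u}} {n : ℤ} (p₂ : Path a (lvRow1.{u} (n + 1))) :
    lower (((p₂.cons (logE n)).cons (idE n)).cons eLamTimes) = (p₂.cons (idE (n + 1))).cons eLamPf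
:=
  rfl

/-- Lowering only changes paths into `𝒩`. [cite: MochizukiAbsTopIII2015, Corollary 4.5 (iii) p.109]
-/
theorem lower_of_ne_obs {a : V3.{u}} : ∀ {b : V3.{u}} (p : Path a b), b ≠ lvObs.{u} → lower p = p
  | _, .nil, _ => rfl
  | _, .cons (b := x) (c := y) p₀ e, hy => by
    rcases V3.cases y with ⟨n, rfl⟩ | rfl | rfl
    · obtain rfl := eq_row1_of_hom_row1 e; rfl
    · obtain ⟨m, rfl⟩ := eq_row1_of_hom_nexus e; rfl
    · exact absurd rfl hy

/-- The level drops by one under lowering (and the bottom paths, of level `0`, are fixed).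
[cite: MochizukiAbsTopIII2015, Corollary 4.5 (iii) p.109] -/
theorem level_lower {a : V3.{u}} (p : Path a lvObs.{u}) (ha : a ≠ lvObs.{u}) :
    level (lower p) = level p - 1 := by
  cases p with
  | nil => exact absurd rfl ha
  | cons p₀ e =>
    obtain rfl := eq_nexus_of_hom_obs e
    rcases hom_obs_eq e with rfl | rfl
    · -- last edge `λ^×`
      cases p₀ with
      | nil => rfl
      | cons p₁ e₁ =>
        obtain ⟨n, rfl⟩ := eq_row1_of_hom_nexus e₁
        obtain rfl : e₁ = idE n := rfl
        cases p₁ with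
        | nil => rfl
        | cons p₂ e₂ =>
          obtain rfl := eq_row1_of_hom_row1 e₂
          obtain rfl := hom_row1_eq e₂
          rw [lower_log_id_lamTimes, level_cons_lamPf, level_cons_lamTimes, nlogs_cons_id,
            nlogs_cons_id, nlogs_cons_log]
          omega
    · rw [lower_cons_lamPf, level_cons_lamTimes, level_cons_lamPf]
      rfl

/-- A path into `𝒩` of positive level ends with `λ^∼` (any prefix) or with `[λ^×]∘[id]∘[log]`.
[cite: MochizukiAbsTopIII2015, Corollary 4.5 (iii) p.109] -/
theorem level_pos_cases {a : V3.{u}} (p : Path a lvObs.{u}) (ha : a ≠ lvObs.{u}) (hp : 0 < level p) :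
    (∃ p₀ : Path a lvNexus.{u}, p = p₀.cons eLamPf) ∨
    (∃ (n : ℤ) (p₂ : Path a (lvRow1.{u} (n + 1))), p = ((p₂.cons (logE n)).cons (idE n)).cons
eLamTimes) := by
  cases p with
  | nil => exact absurd rfl ha
  | cons p₀ e =>
    obtain rfl := eq_nexus_of_hom_obs e
    rcases hom_obs_eq e with rfl | rfl
    · right
      cases p₀ with
      | nil =>
        have h0 : level ((Path.nil : Path lvNexus.{u} lvNexus).cons eLamTimes) = 0 := rfl
        omega
      | cons p₁ e₁ =>
        obtain ⟨n, rfl⟩ := eq_row1_of_hom_nexus e₁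
        obtain rfl : e₁ = idE n := rfl
        cases p₁ with
        | nil =>
          have h0 : level (((Path.nil : Path (lvRow1.{u} n) (lvRow1 n)).cons (idE n)).cons eLamTimes) = 0 :=
            rfl
          omega
        | cons p₂ e₂ =>
          obtain rfl := eq_row1_of_hom_row1 e₂
          obtain rfl := hom_row1_eq e₂
          exact ⟨n, p₂, rfl⟩
    · exact Or.inl ⟨p₀, rfl⟩

/-- Lowering a path of positive level commutes with pre-composition. [cite: MochizukiAbsTopIII2015,
Corollary 4.5 (iii) p.109] -/
theorem lower_comp_of_level_pos {c a : V3.{u}} (r : Path c a) (p : Path a lvObs.{u}) (ha : a ≠ lvObs.{u})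
    (hp : 0 < level p) : lower (r.comp p) = r.comp (lower p) := by
  rcases level_pos_cases p ha hp with ⟨p₀, rfl⟩ | ⟨n, p₂, rfl⟩
  · rfl
  · rfl

/-- Iterated lowering within the level commutes with pre-composition. [cite: MochizukiAbsTopIII2015,
Corollary 4.5 (iii) p.109] -/
theorem iter_lower_comp {c a : V3.{u}} (r : Path c a) (ha : a ≠ lvObs.{u}) :
    ∀ (d : ℕ) (p : Path a lvObs.{u}), d ≤ level p → lower^[d] (r.comp p) = r.comp (lower^[d] p)
  | 0, _, _ => rfl
  | d + 1, p, hd => by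
    have hp : 0 < level p := by omega
    have hd' : d ≤ level (lower p) := by rw [level_lower p ha]; omega
    show lower^[d] (lower (r.comp p)) = r.comp (lower^[d] (lower p))
    rw [lower_comp_of_level_pos r p ha hp]
    exact iter_lower_comp r ha d (lower p) hd'

end Literature.AnabelianGeometry.AbsoluteAnabelian.AbsTopIII
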